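import Mathlib.LinearAlgebra.Matrix.Block
import Literature.Analysis.Toeplitz.DominatedMatrix
import HarnessLib

/-!
# Triangular Toeplitz matrices and their Hankel commutator

Topic `Analysis/Toeplitz`, namespace `Literature.Analysis.Toeplitz`. The concrete matrices of the
Wiener–Hopf / Basor–Helton factorisation used in the proof of the strong Szegő limit theorem
(Deift–Its–Krasovsky 2013, §3; `StrongSzegoGeometric.lean`), for ONE-SIDED coefficient sequences
`a c : ℕ → ℂ`:

* `lowerT a` — the lower triangular Toeplitz matrix `(a (i - j))_{j ≤ i}` = `T(φ₊)` for an analytic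
  symbol `φ₊(t) = ∑ a n tⁿ`;
* `upperT c` — the upper triangular Toeplitz matrix `(c (j - i))_{i ≤ j}` = `T(φ₋)` for an
  antianalytic symbol `φ₋(t) = ∑ c n t⁻ⁿ`;
* `hankelT a c` — the Hankel product `(∑_p a (i+p+1) c (j+p+1))_{i,j}` = `H(φ₊) H(φ̃₋)`;
* `cauchyProd a a'` — the Cauchy product (coefficients of `φ₊ φ₊'`);
* `twoSided a c` — the two-sided coefficient sequence of the product symbol `φ₋ φ₊`.

and proves the algebra (Böttcher–Silbermann 1999, Prop. 1.10/§1.5 type identities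
`T(fg) = T(f)T(g) + H(f)H(g̃)`, specialised to triangular factors, as exact identities of infinite
matrices with absolutely convergent entries):

* `imul_lowerT_lowerT : L(a) L(a') = L(a ⋆ a')`, `imul_upperT_upperT : U(c) U(c') = U(c ⋆ c')`
  (finite sums, no hypotheses), `lowerT_delta = 1 = upperT_delta`;
* `imul_lowerT_upperT_apply` — `L(a) U(c)` entrywise (a finite sum);
* **`imul_upperT_lowerT : U(c) L(a) = L(a) U(c) + hankelT a c`** — the commutator of the two
  triangular Toeplitz matrices is the Hankel product (`[T(φ₋), T(φ₊)] = H(φ₊)H(φ̃₋)`), for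
  geometrically bounded `a, c`;
* `imul_upperT_lowerT_apply_eq_twoSided : (U(c) L(a)) i j = twoSided a c (i - j)` — `U L = T(φ₋φ₊)` is
  the Toeplitz matrix of the product symbol;
* domination: `lowerT`, `upperT` are dominated with a geometric Toeplitz majorant (`IsDom`) and
  `hankelT` is a corner kernel (`IsCorner`), so all three live in the ring `DomMat`;
* sections: `finSection_imul_lowerT`, `finSection_imul_upperT` (`P_n L = P_n L P_n`,
  `U P_n = P_n U P_n`), `det_finSection_lowerT/upperT` (`= (a 0)^n`), and
  `finSection_toeplitz : toeplitzMatrix b n = finSection n (i j ↦ b (i - j))`.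

## References

* A. Böttcher, B. Silbermann, *Introduction to Large Truncated Toeplitz Matrices* (Springer 1999), §1.5.
* P. Deift, A. Its, I. Krasovsky, Comm. Pure Appl. Math. 66 (2013) 1360–1438, §3.
-/

noncomputable section

open Finset Filter
open scoped _root_.Topology BigOperators

namespace Literature.Analysis.Toeplitz

/-! ### Geometrically bounded one-sided sequences -/

/-- **Geometric bound** `‖a n‖ ≤ D rⁿ` for a one-sided sequence. [folklore] -/
def IsGeom (r D : ℝ) (a : ℕ → ℂ) : Prop := ∀ n, ‖a n‖ ≤ D * r ^ n

namespace IsGeom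

variable {r D D' : ℝ} {a a' : ℕ → ℂ}

/-- The constant is nonnegative. [folklore] -/
theorem nonneg (h : IsGeom r D a) : 0 ≤ D := by
  have := h 0; simp only [pow_zero, mul_one] at this; exact (norm_nonneg _).trans this

/-- Weakening. [folklore] -/
theorem mono (h : IsGeom r D a) (hr : 0 ≤ r) (hD : D ≤ D') : IsGeom r D' a :=
  fun n => (h n).trans (mul_le_mul_of_nonneg_right hD (pow_nonneg hr _))

/-- Weakening the rate. [folklore] -/
theorem mono_rate {s : ℝ} (h : IsGeom r D a) (hr : 0 ≤ r) (hrs : r ≤ s) : IsGeom s D a :=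
  fun n => (h n).trans (mul_le_mul_of_nonneg_left (pow_le_pow_left₀ hr hrs n) h.nonneg)

/-- Sums. [folklore] -/
theorem add (h : IsGeom r D a) (h' : IsGeom r D' a') : IsGeom r (D + D') (a + a') := fun n =>
  calc ‖(a + a') n‖ ≤ ‖a n‖ + ‖a' n‖ := norm_add_le _ _
    _ ≤ D * r ^ n + D' * r ^ n := add_le_add (h n) (h' n)
    _ = (D + D') * r ^ n := by ring

/-- Differences. [folklore] -/
theorem sub (h : IsGeom r D a) (h' : IsGeom r D' a') : IsGeom r (D + D') (a - a') := fun n =>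
  calc ‖(a - a') n‖ ≤ ‖a n‖ + ‖a' n‖ := norm_sub_le _ _
    _ ≤ D * r ^ n + D' * r ^ n := add_le_add (h n) (h' n)
    _ = (D + D') * r ^ n := by ring

/-- Scalar multiples. [folklore] -/
theorem smul (h : IsGeom r D a) (t : ℂ) : IsGeom r (‖t‖ * D) (t • a) := fun n => by
  rw [Pi.smul_apply, smul_eq_mul, norm_mul, mul_assoc]
  exact mul_le_mul_of_nonneg_left (h n) (norm_nonneg t)

/-- The zero sequence. [folklore] -/
theorem zero (r : ℝ) : IsGeom r 0 (0 : ℕ → ℂ) := fun n => by simp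

end IsGeom

/-- The Kronecker delta sequence `δ₀`. [folklore] -/
def delta : ℕ → ℂ := fun n => if n = 0 then 1 else 0

/-- `δ₀ 0 = 1`. [folklore] -/
@[simp] theorem delta_zero : delta 0 = 1 := rfl

/-- `δ₀ (n+1) = 0`. [folklore] -/
@[simp] theorem delta_succ (n : ℕ) : delta (n + 1) = 0 := rfl

/-- `δ₀ n = 0` for `n ≠ 0`. [folklore] -/
theorem delta_of_ne_zero {n : ℕ} (h : n ≠ 0) : delta n = 0 := if_neg h

/-- `δ₀` is geometrically bounded with constant `1` (any rate `r ≥ 0`). [folklore] -/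
theorem isGeom_delta {r : ℝ} (hr : 0 ≤ r) : IsGeom r 1 delta := by
  intro n
  rcases Nat.eq_zero_or_pos n with rfl | hn
  · simp
  · rw [delta_of_ne_zero hn.ne']; simpa using pow_nonneg hr n

/-! ### The matrices -/

/-- The **lower triangular Toeplitz matrix** `L(a) = (a (i - j))_{j ≤ i}` of a one-sided sequence —
`T(φ₊)` for `φ₊ = ∑ a n tⁿ`. [folklore] -/
def lowerT (a : ℕ → ℂ) : Matrix ℕ ℕ ℂ := fun i j => if j ≤ i then a (i - j) else 0

/-- The **upper triangular Toeplitz matrix** `U(c) = (c (j - i))_{i ≤ j}` of a one-sided sequence —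
`T(φ₋)` for `φ₋ = ∑ c n t⁻ⁿ`. [folklore] -/
def upperT (c : ℕ → ℂ) : Matrix ℕ ℕ ℂ := fun i j => if i ≤ j then c (j - i) else 0

/-- The **Hankel product** `(H(φ₊) H(φ̃₋)) i j = ∑_p a (i+p+1) c (j+p+1)`. [folklore] -/
def hankelT (a c : ℕ → ℂ) : Matrix ℕ ℕ ℂ := fun i j => ∑' p, a (i + p + 1) * c (j + p + 1)

/-- The **Cauchy product** `(a ⋆ a') n = ∑_{q ≤ n} a q a' (n - q)`. [folklore] -/
def cauchyProd (a a' : ℕ → ℂ) (n : ℕ) : ℂ := ∑ p ∈ antidiagonal n, a p.1 * a' p.2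

/-- Entries of `lowerT`. [folklore] -/
theorem lowerT_apply (a : ℕ → ℂ) (i j : ℕ) : lowerT a i j = if j ≤ i then a (i - j) else 0 := rfl

/-- Entries of `upperT`. [folklore] -/
theorem upperT_apply (c : ℕ → ℂ) (i j : ℕ) : upperT c i j = if i ≤ j then c (j - i) else 0 := rfl

/-- Entries of `hankelT`. [folklore] -/
theorem hankelT_apply (a c : ℕ → ℂ) (i j : ℕ) :
    hankelT a c i j = ∑' p, a (i + p + 1) * c (j + p + 1) := rfl

/-- `upperT` is the transpose of `lowerT`. [folklore] -/
theorem upperT_eq_transpose (c : ℕ → ℂ) : upperT c = (lowerT c).transpose := by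
  ext i j; rfl

/-- Strictly upper entries of `lowerT` vanish. [folklore] -/
theorem lowerT_of_lt (a : ℕ → ℂ) {i j : ℕ} (h : i < j) : lowerT a i j = 0 := if_neg (not_le.2 h)

/-- Strictly lower entries of `upperT` vanish. [folklore] -/
theorem upperT_of_lt (c : ℕ → ℂ) {i j : ℕ} (h : j < i) : upperT c i j = 0 := if_neg (not_le.2 h)

/-- Diagonal of `lowerT`. [folklore] -/
@[simp] theorem lowerT_diag (a : ℕ → ℂ) (i : ℕ) : lowerT a i i = a 0 := by simp [lowerT_apply]

/-- Diagonal of `upperT`. [folklore] -/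
@[simp] theorem upperT_diag (c : ℕ → ℂ) (i : ℕ) : upperT c i i = c 0 := by simp [upperT_apply]

/-- `lowerT` is additive. [folklore] -/
theorem lowerT_add (a a' : ℕ → ℂ) : lowerT (a + a') = lowerT a + lowerT a' := by
  ext i j; simp only [lowerT_apply, Matrix.add_apply, Pi.add_apply]; split_ifs <;> simp

/-- `lowerT` is homogeneous. [folklore] -/
theorem lowerT_smul (t : ℂ) (a : ℕ → ℂ) : lowerT (t • a) = t • lowerT a := by
  ext i j; simp only [lowerT_apply, Matrix.smul_apply, Pi.smul_apply, smul_eq_mul]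
  split_ifs <;> simp

/-- `lowerT` commutes with subtraction. [folklore] -/
theorem lowerT_sub (a a' : ℕ → ℂ) : lowerT (a - a') = lowerT a - lowerT a' := by
  ext i j; simp only [lowerT_apply, Matrix.sub_apply, Pi.sub_apply]; split_ifs <;> simp

/-- `upperT` is additive. [folklore] -/
theorem upperT_add (c c' : ℕ → ℂ) : upperT (c + c') = upperT c + upperT c' := by
  ext i j; simp only [upperT_apply, Matrix.add_apply, Pi.add_apply]; split_ifs <;> simp

/-- `upperT` is homogeneous. [folklore] -/
theorem upperT_smul (t : ℂ) (c : ℕ → ℂ) : upperT (t • c) = t • upperT c := by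
  ext i j; simp only [upperT_apply, Matrix.smul_apply, Pi.smul_apply, smul_eq_mul]
  split_ifs <;> simp

/-- `upperT` commutes with subtraction. [folklore] -/
theorem upperT_sub (c c' : ℕ → ℂ) : upperT (c - c') = upperT c - upperT c' := by
  ext i j; simp only [upperT_apply, Matrix.sub_apply, Pi.sub_apply]; split_ifs <;> simp

/-- `L(δ₀) = 1`. [folklore] -/
@[simp] theorem lowerT_delta : lowerT delta = 1 := by
  ext i j
  simp only [lowerT_apply, delta, Matrix.one_apply]
  by_cases h : i = j
  · subst h; simp
  · by_cases hji : j ≤ i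
    · have : i - j ≠ 0 := by omega
      simp [hji, this, h]
    · simp [hji, h]

/-- `U(δ₀) = 1`. [folklore] -/
@[simp] theorem upperT_delta : upperT delta = 1 := by
  rw [upperT_eq_transpose, lowerT_delta, Matrix.transpose_one]

/-- `hankelT` is additive in the first argument (under summability, here: geometric bounds). [folklore] -/
theorem hankelT_apply_comm (a c : ℕ → ℂ) (i j : ℕ) : hankelT a c i j = hankelT c a j i := by
  simp only [hankelT_apply]; exact tsum_congr fun p => mul_comm _ _

/-! ### The Cauchy product -/

/-- The Cauchy product as a sum over `range (n+1)`. [folklore] -/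
theorem cauchyProd_eq_sum_range (a a' : ℕ → ℂ) (n : ℕ) :
    cauchyProd a a' n = ∑ q ∈ range (n + 1), a q * a' (n - q) :=
  Nat.sum_antidiagonal_eq_sum_range_succ (fun p q => a p * a' q) n

/-- The Cauchy product is commutative. [folklore] -/
theorem cauchyProd_comm (a a' : ℕ → ℂ) : cauchyProd a a' = cauchyProd a' a := by
  funext n
  rw [cauchyProd, cauchyProd, ← Nat.sum_antidiagonal_swap]
  exact sum_congr rfl fun p _ => by simp [mul_comm]

/-- `δ₀` is a left unit of the Cauchy product. [folklore] -/
@[simp] theorem cauchyProd_delta_left (a : ℕ → ℂ) : cauchyProd delta a = a := by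
  funext n
  rw [cauchyProd_eq_sum_range, sum_eq_single 0]
  · simp
  · intro q _ hq; simp [delta_of_ne_zero hq]
  · intro h; simp at h

/-- `δ₀` is a right unit of the Cauchy product. [folklore] -/
@[simp] theorem cauchyProd_delta_right (a : ℕ → ℂ) : cauchyProd a delta = a := by
  rw [cauchyProd_comm, cauchyProd_delta_left]

/-- `(a ⋆ a') 0 = a 0 a' 0`. [folklore] -/
@[simp] theorem cauchyProd_zero (a a' : ℕ → ℂ) : cauchyProd a a' 0 = a 0 * a' 0 := by
  simp [cauchyProd]

/-- **Geometric sequences are closed under the Cauchy product**: constant `D D' (n+1)` absorbed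
into any larger rate; here the crude bound with the SAME rate and the factor `(n + 1)` made explicit. [folklore] -/
theorem norm_cauchyProd_le {r D D' : ℝ} {a a' : ℕ → ℂ} (ha : IsGeom r D a) (ha' : IsGeom r D' a')
    (hr : 0 ≤ r) (n : ℕ) : ‖cauchyProd a a' n‖ ≤ D * D' * (n + 1) * r ^ n := by
  rw [cauchyProd_eq_sum_range]
  calc ‖∑ q ∈ range (n + 1), a q * a' (n - q)‖ ≤ ∑ q ∈ range (n + 1), ‖a q * a' (n - q)‖ :=
        norm_sum_le _ _
    _ ≤ ∑ q ∈ range (n + 1), D * D' * r ^ n := by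
        refine sum_le_sum fun q hq => ?_
        rw [norm_mul]
        have hqn : q ≤ n := Nat.lt_succ_iff.1 (mem_range.1 hq)
        calc ‖a q‖ * ‖a' (n - q)‖ ≤ D * r ^ q * (D' * r ^ (n - q)) :=
              mul_le_mul (ha q) (ha' _) (norm_nonneg _) (mul_nonneg ha.nonneg (pow_nonneg hr _))
          _ = D * D' * r ^ n := by
              rw [show D * r ^ q * (D' * r ^ (n - q)) = D * D' * (r ^ q * r ^ (n - q)) by ring,
                ← pow_add, Nat.add_sub_cancel' hqn]
    _ = D * D' * (n + 1) * r ^ n := by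
        rw [sum_const, card_range, nsmul_eq_mul]; push_cast; ring

/-! ### Products of triangular Toeplitz matrices -/

/-- **`L(a) L(a') = L(a ⋆ a')`** — lower triangular Toeplitz matrices multiply like power series
(the defining `tsum` is a finite sum; no hypotheses). [folklore] -/
theorem imul_lowerT_lowerT (a a' : ℕ → ℂ) : imul (lowerT a) (lowerT a') = lowerT (cauchyProd a a') := by
  ext i j
  rw [imul_apply, lowerT_apply]
  -- the summand vanishes off `[j, i]`
  have hsupp : ∀ m ∉ Icc j i, lowerT a i m * lowerT a' m j = 0 := by
    intro m hm
    rw [mem_Icc, not_and_or, not_le, not_le] at hm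
    rcases hm with h | h
    · rw [lowerT_of_lt a' h, mul_zero]
    · rw [lowerT_of_lt a h, zero_mul]
  rw [tsum_eq_sum hsupp]
  split_ifs with hji
  · rw [cauchyProd_eq_sum_range]
    -- reindex `q = i - m`
    refine sum_nbij' (fun m => i - m) (fun q => i - q) (fun m hm => ?_) (fun q hq => ?_)
      (fun m hm => ?_) (fun q hq => ?_) (fun m hm => ?_)
    · rw [mem_Icc] at hm; rw [mem_range]; omega
    · rw [mem_range] at hq; rw [mem_Icc]; omega
    · rw [mem_Icc] at hm; omega
    · rw [mem_range] at hq; omega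
    · rw [mem_Icc] at hm
      rw [lowerT_apply, lowerT_apply, if_pos hm.2, if_pos hm.1]
      congr 2; omega
  · rw [not_le] at hji
    refine sum_eq_zero fun m hm => ?_
    rw [mem_Icc] at hm
    omega

/-- Transpose reverses `imul`. [folklore] -/
theorem transpose_imul (A B : Matrix ℕ ℕ ℂ) : (imul A B).transpose = imul B.transpose A.transpose := by
  ext i j
  simp only [Matrix.transpose_apply, imul_apply]
  exact tsum_congr fun m => mul_comm _ _

/-- **`U(c) U(c') = U(c ⋆ c')`** — upper triangular Toeplitz matrices multiply like power series in
`1/t`. [folklore] -/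
theorem imul_upperT_upperT (c c' : ℕ → ℂ) : imul (upperT c) (upperT c') = upperT (cauchyProd c c') := by
  have h := congrArg Matrix.transpose (imul_lowerT_lowerT c' c)
  rw [transpose_imul, ← upperT_eq_transpose, ← upperT_eq_transpose, ← upperT_eq_transpose,
    cauchyProd_comm] at h
  exact h

/-- **`L(a) U(c)` entrywise**: `∑_{m ≤ min i j} a (i - m) c (j - m)` (a finite sum). [folklore] -/
theorem imul_lowerT_upperT_apply (a c : ℕ → ℂ) (i j : ℕ) :
    imul (lowerT a) (upperT c) i j = ∑ m ∈ range (min i j + 1), a (i - m) * c (j - m) := by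
  rw [imul_apply]
  have hsupp : ∀ m ∉ range (min i j + 1), lowerT a i m * upperT c m j = 0 := by
    intro m hm
    rw [mem_range, not_lt] at hm
    rcases le_or_gt m i with h | h
    · have : j < m := by omega
      rw [upperT_of_lt c this, mul_zero]
    · rw [lowerT_of_lt a h, zero_mul]
  rw [tsum_eq_sum hsupp]
  refine sum_congr rfl fun m hm => ?_
  rw [mem_range] at hm
  rw [lowerT_apply, upperT_apply, if_pos (by omega), if_pos (by omega)]

/-! ### The commutation rule `U L = L U + H H̃` -/

section Commutator

variable {r D D' : ℝ} {a c : ℕ → ℂ}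

/-- The terms of `U(c) L(a)` at `(i, j)`: supported on `m ≥ max i j`, geometrically small. [folklore] -/
theorem summable_upperT_mul_lowerT (ha : IsGeom r D a) (hc : IsGeom r D' c) (hr : 0 < r) (hr1 : r < 1)
    (i j : ℕ) : Summable fun m => upperT c i m * lowerT a m j := by
  have hnn : ∀ m, 0 ≤ D' * D * r⁻¹ ^ (i + j) * (r ^ 2) ^ m := fun m =>
    mul_nonneg (mul_nonneg (mul_nonneg hc.nonneg ha.nonneg) (pow_nonneg (inv_nonneg.2 hr.le) _))
      (pow_nonneg (pow_nonneg hr.le 2) _)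
  refine Summable.of_norm_bounded (g := fun m => D' * D * r⁻¹ ^ (i + j) * (r ^ 2) ^ m) ?_ (fun m => ?_)
  · exact (summable_geometric_of_lt_one (pow_nonneg hr.le 2) (pow_lt_one₀ hr.le hr1 two_ne_zero)).mul_left _
  · rw [upperT_apply, lowerT_apply]
    by_cases h1 : i ≤ m
    · by_cases h2 : j ≤ m
      · rw [if_pos h1, if_pos h2, norm_mul]
        have key : r ^ (m - i) * r ^ (m - j) = r⁻¹ ^ (i + j) * (r ^ 2) ^ m := by
          rw [inv_pow, ← pow_mul, eq_inv_mul_iff_mul_eq₀ (pow_ne_zero _ hr.ne'), ← pow_add, ← pow_add]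
          congr 1; omega
        calc ‖c (m - i)‖ * ‖a (m - j)‖ ≤ D' * r ^ (m - i) * (D * r ^ (m - j)) :=
              mul_le_mul (hc _) (ha _) (norm_nonneg _) (mul_nonneg hc.nonneg (pow_nonneg hr.le _))
          _ = D' * D * (r ^ (m - i) * r ^ (m - j)) := by ring
          _ = D' * D * r⁻¹ ^ (i + j) * (r ^ 2) ^ m := by rw [key]; ring
      · rw [if_neg h2, mul_zero, norm_zero]; exact hnn m
    · rw [if_neg h1, zero_mul, norm_zero]; exact hnn m

/-- The terms of the Hankel product are absolutely summable. [folklore] -/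
theorem summable_hankelT (ha : IsGeom r D a) (hc : IsGeom r D' c) (hr : 0 ≤ r) (hr1 : r < 1)
    (i j : ℕ) : Summable fun p => a (i + p + 1) * c (j + p + 1) := by
  refine Summable.of_norm_bounded (g := fun p => D * D' * r ^ (i + j + 2) * (r ^ 2) ^ p)
    ((summable_geometric_of_lt_one (pow_nonneg hr 2) (pow_lt_one₀ hr hr1 two_ne_zero)).mul_left _)
    (fun p => ?_)
  rw [norm_mul]
  calc ‖a (i + p + 1)‖ * ‖c (j + p + 1)‖ ≤ D * r ^ (i + p + 1) * (D' * r ^ (j + p + 1)) :=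
        mul_le_mul (ha _) (hc _) (norm_nonneg _) (mul_nonneg ha.nonneg (pow_nonneg hr _))
    _ = D * D' * r ^ (i + j + 2) * (r ^ 2) ^ p := by
        rw [← pow_mul, show D * r ^ (i + p + 1) * (D' * r ^ (j + p + 1)) =
          D * D' * (r ^ (i + p + 1) * r ^ (j + p + 1)) by ring, ← pow_add,
          show i + p + 1 + (j + p + 1) = i + j + 2 + 2 * p by omega, pow_add]
        ring

/-- **The Hankel product is a corner kernel**: `|hankelT a c i j| ≤ D D' r²/(1-r²) · r^{i+j}`. [folklore] -/
theorem isCorner_hankelT (ha : IsGeom r D a) (hc : IsGeom r D' c) (hr : 0 ≤ r) (hr1 : r < 1) :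
    IsCorner r (D * D' * r ^ 2 / (1 - r ^ 2)) (hankelT a c) := by
  intro i j
  have hr2 : r ^ 2 < 1 := pow_lt_one₀ hr hr1 two_ne_zero
  have hgeo := summable_geometric_of_lt_one (pow_nonneg hr 2) hr2
  have hle : ∀ p, ‖a (i + p + 1) * c (j + p + 1)‖ ≤ D * D' * r ^ (i + j + 2) * (r ^ 2) ^ p := by
    intro p
    rw [norm_mul]
    calc ‖a (i + p + 1)‖ * ‖c (j + p + 1)‖ ≤ D * r ^ (i + p + 1) * (D' * r ^ (j + p + 1)) :=
          mul_le_mul (ha _) (hc _) (norm_nonneg _) (mul_nonneg ha.nonneg (pow_nonneg hr _))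
      _ = D * D' * r ^ (i + j + 2) * (r ^ 2) ^ p := by
          rw [← pow_mul, show D * r ^ (i + p + 1) * (D' * r ^ (j + p + 1)) =
            D * D' * (r ^ (i + p + 1) * r ^ (j + p + 1)) by ring, ← pow_add,
            show i + p + 1 + (j + p + 1) = i + j + 2 + 2 * p by omega, pow_add]
          ring
  have hs : Summable fun p => ‖a (i + p + 1) * c (j + p + 1)‖ :=
    Summable.of_nonneg_of_le (fun p => norm_nonneg _) hle (hgeo.mul_left _)
  rw [hankelT_apply]
  calc ‖∑' p, a (i + p + 1) * c (j + p + 1)‖ ≤ ∑' p, ‖a (i + p + 1) * c (j + p + 1)‖ :=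
        norm_tsum_le_tsum_norm hs
    _ ≤ ∑' p, D * D' * r ^ (i + j + 2) * (r ^ 2) ^ p := hs.tsum_le_tsum hle (hgeo.mul_left _)
    _ = D * D' * r ^ (i + j + 2) * (1 - r ^ 2)⁻¹ := by
        rw [tsum_mul_left, tsum_geometric_of_lt_one (pow_nonneg hr 2) hr2]
    _ = D * D' * r ^ 2 / (1 - r ^ 2) * r ^ (i + j) := by rw [pow_add]; ring

/-- **The commutation rule `U(c) L(a) = L(a) U(c) + H H̃`** (`[T(φ₋), T(φ₊)] = H(φ₊) H(φ̃₋)`; the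
entry identity is the splitting of `∑_{m ≥ max i j} c (m - i) a (m - j)` at `m = i + j`, the first
part being `(L U) i j` reflected and the second the Hankel product). [folklore] -/
theorem imul_upperT_lowerT (ha : IsGeom r D a) (hc : IsGeom r D' c) (hr : 0 < r) (hr1 : r < 1) :
    imul (upperT c) (lowerT a) = imul (lowerT a) (upperT c) + hankelT a c := by
  ext i j
  rw [Matrix.add_apply, imul_apply, imul_lowerT_upperT_apply, hankelT_apply]
  have hs := summable_upperT_mul_lowerT ha hc hr hr1 i j
  rw [← hs.sum_add_tsum_nat_add (i + j + 1)]
  congr 1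
  · -- the finite part: terms `m ∈ [max i j, i + j]`, reflected onto `m' = i + j - m ∈ [0, min i j]`
    have h1 : ∑ m ∈ range (i + j + 1), upperT c i m * lowerT a m j =
        ∑ m ∈ range (i + j + 1), (if m ≤ min i j then a (i - m) * c (j - m) else 0) := by
      rw [← Finset.sum_range_reflect (fun m => if m ≤ min i j then a (i - m) * c (j - m) else 0)
        (i + j + 1)]
      refine sum_congr rfl fun m hm => ?_
      rw [mem_range] at hm
      rw [upperT_apply, lowerT_apply]
      by_cases him : i ≤ m
      · by_cases hjm : j ≤ m
        · rw [if_pos him, if_pos hjm, if_pos (by omega), mul_comm]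
          congr 2 <;> omega
        · rw [if_neg hjm, mul_zero, if_neg (by omega)]
      · rw [if_neg him, zero_mul, if_neg (by omega)]
    rw [h1, ← sum_filter]
    have hfil : (range (i + j + 1)).filter (fun m => m ≤ min i j) = range (min i j + 1) := by
      ext m; simp only [mem_filter, mem_range]; omega
    rw [hfil]
  · refine tsum_congr fun p => ?_
    rw [upperT_apply, lowerT_apply, if_pos (by omega), if_pos (by omega), mul_comm]
    congr 2 <;> omega

end Commutator

/-! ### The two-sided symbol of `U L` -/

/-- Extension of a one-sided sequence by zero to `ℤ`. [folklore] -/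
def extendZ (c : ℕ → ℂ) (m : ℤ) : ℂ := if 0 ≤ m then c m.toNat else 0

/-- `extendZ c n = c n` on naturals. [folklore] -/
@[simp] theorem extendZ_natCast (c : ℕ → ℂ) (n : ℕ) : extendZ c n = c n := by
  simp [extendZ]

/-- `extendZ c m = 0` for negative `m`. [folklore] -/
theorem extendZ_of_neg (c : ℕ → ℂ) {m : ℤ} (h : m < 0) : extendZ c m = 0 := if_neg (not_le.2 h)

/-- The **two-sided coefficient sequence of the product symbol `φ₋ φ₊`**:
`b k = ∑_{q ≥ 0} a q c (q - k)` (the coefficient of `t^k` in `(∑ a q t^q)(∑ c n t⁻ⁿ)`). [folklore] -/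
def twoSided (a c : ℕ → ℂ) (k : ℤ) : ℂ := ∑' q : ℕ, a q * extendZ c ((q : ℤ) - k)

/-- **`U(c) L(a)` is the Toeplitz matrix of the product symbol**: `(U L) i j = twoSided a c (i - j)`
(reindexing `m = j + q`). [folklore] -/
theorem imul_upperT_lowerT_apply_eq_twoSided (a c : ℕ → ℂ) (i j : ℕ) :
    imul (upperT c) (lowerT a) i j = twoSided a c ((i : ℤ) - j) := by
  rw [imul_apply, twoSided]
  -- `m ↦ j + m` hits exactly the support of the left side
  have hzero : ∀ m ∉ Set.range (fun q : ℕ => j + q), upperT c i m * lowerT a m j = 0 := by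
    intro m hm
    have hmj : m < j := by
      by_contra h
      exact hm ⟨m - j, by simp only; omega⟩
    rw [lowerT_of_lt a hmj, mul_zero]
  rw [← Function.Injective.tsum_eq (g := fun q : ℕ => j + q) (fun q q' h => by simpa using h)
    (fun m hm => by
      by_contra h
      exact hm (hzero m h))]
  refine tsum_congr fun q => ?_
  rw [upperT_apply, lowerT_apply, if_pos (Nat.le_add_right j q), Nat.add_sub_cancel_left, mul_comm]
  by_cases h : i ≤ j + q
  · rw [if_pos h]
    have : ((q : ℤ) - ((i : ℤ) - j)) = ((j + q - i : ℕ) : ℤ) := by omega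
    rw [this, extendZ_natCast]
  · rw [if_neg h, extendZ_of_neg c (by omega), mul_zero]

/-! ### Domination -/

section Domination

variable {r σ D D' : ℝ} {a c : ℕ → ℂ}

/-- The symmetric geometric majorant `D r^{|k|}` on `ℤ`. [folklore] -/
def geomMajorant (r D : ℝ) (k : ℤ) : ℝ := D * r ^ k.natAbs

/-- `lowerT a` is Toeplitz-dominated by `D r^{|k|}`. [folklore] -/
theorem isDom_lowerT (ha : IsGeom r D a) (hr : 0 ≤ r) (σ : ℝ) : IsDom σ (geomMajorant r D) 0 (lowerT a) := by
  refine IsDom.of_toeplitz fun i j => ?_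
  rw [lowerT_apply, geomMajorant]
  split_ifs with h
  · have : (((i : ℤ) - j)).natAbs = i - j := by omega
    rw [this]; exact ha _
  · rw [norm_zero]; exact mul_nonneg ha.nonneg (pow_nonneg hr _)

/-- `upperT c` is Toeplitz-dominated by `D r^{|k|}`. [folklore] -/
theorem isDom_upperT (hc : IsGeom r D c) (hr : 0 ≤ r) (σ : ℝ) : IsDom σ (geomMajorant r D) 0 (upperT c) := by
  refine IsDom.of_toeplitz fun i j => ?_
  rw [upperT_apply, geomMajorant]
  split_ifs with h
  · have : (((i : ℤ) - j)).natAbs = j - i := by omega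
    rw [this]; exact hc _
  · rw [norm_zero]; exact mul_nonneg hc.nonneg (pow_nonneg hr _)

/-- The geometric majorant is a weighted sequence at every larger rate. [folklore] -/
theorem isWSeq_geomMajorant (hσ : 0 < σ) (hr : 0 ≤ r) (hrσ : r < σ) (hD : 0 ≤ D) :
    IsWSeq σ (geomMajorant r D) :=
  isWSeq_geometric hσ hr hrσ hD

/-- The Hankel product is a corner kernel at every larger rate. [folklore] -/
theorem isCorner_hankelT_of_le (ha : IsGeom r D a) (hc : IsGeom r D' c) (hr : 0 ≤ r) (hr1 : r < 1)
    (hrσ : r ≤ σ) : IsCorner σ (D * D' * r ^ 2 / (1 - r ^ 2)) (hankelT a c) := fun i j =>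
  (isCorner_hankelT ha hc hr hr1 i j).trans (mul_le_mul_of_nonneg_left (pow_le_pow_left₀ hr hrσ _)
    (div_nonneg (mul_nonneg (mul_nonneg ha.nonneg hc.nonneg) (sq_nonneg r))
      (by nlinarith [pow_lt_one₀ hr hr1 two_ne_zero, pow_nonneg hr 2])))

/-- The corner constant of the Hankel product is nonnegative. [folklore] -/
theorem hankelT_const_nonneg (ha : IsGeom r D a) (hc : IsGeom r D' c) (hr : 0 ≤ r) (hr1 : r < 1) :
    0 ≤ D * D' * r ^ 2 / (1 - r ^ 2) :=
  div_nonneg (mul_nonneg (mul_nonneg ha.nonneg hc.nonneg) (sq_nonneg r))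
    (by nlinarith [pow_lt_one₀ hr hr1 two_ne_zero, pow_nonneg hr 2])

end Domination

/-! ### Finite sections of triangular products -/

/-- **`P_n (L X) P_n = (P_n L P_n)(P_n X P_n)`** for a lower triangular Toeplitz `L = L(a)`: row
`i < n` of `L` is supported on columns `≤ i < n` (no summability needed). [folklore] -/
theorem finSection_imul_lowerT (n : ℕ) (a : ℕ → ℂ) (X : Matrix ℕ ℕ ℂ) :
    finSection n (imul (lowerT a) X) = finSection n (lowerT a) * finSection n X := by
  rw [← finSection_imulTrunc]
  ext i j
  simp only [finSection_apply, imul_apply, imulTrunc_apply]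
  refine tsum_eq_sum fun m hm => ?_
  rw [mem_range, not_lt] at hm
  rw [lowerT_of_lt a (lt_of_lt_of_le i.isLt hm), zero_mul]

/-- **`P_n (X U) P_n = (P_n X P_n)(P_n U P_n)`** for an upper triangular Toeplitz `U = U(c)`: column
`j < n` of `U` is supported on rows `≤ j < n`. [folklore] -/
theorem finSection_imul_upperT (n : ℕ) (X : Matrix ℕ ℕ ℂ) (c : ℕ → ℂ) :
    finSection n (imul X (upperT c)) = finSection n X * finSection n (upperT c) := by
  rw [← finSection_imulTrunc]
  ext i j
  simp only [finSection_apply, imul_apply, imulTrunc_apply]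
  refine tsum_eq_sum fun m hm => ?_
  rw [mem_range, not_lt] at hm
  rw [upperT_of_lt c (lt_of_lt_of_le j.isLt hm), mul_zero]

/-- `det (P_n L(a) P_n) = (a 0)^n`. [folklore] -/
theorem det_finSection_lowerT (n : ℕ) (a : ℕ → ℂ) : (finSection n (lowerT a)).det = a 0 ^ n := by
  rw [Matrix.det_of_lowerTriangular]
  · simp
  · intro i j hij
    simp only [OrderDual.toDual_lt_toDual, Fin.lt_def] at hij
    exact lowerT_of_lt a hij

/-- `det (P_n U(c) P_n) = (c 0)^n`. [folklore] -/
theorem det_finSection_upperT (n : ℕ) (c : ℕ → ℂ) : (finSection n (upperT c)).det = c 0 ^ n := by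
  rw [Matrix.det_of_upperTriangular]
  · simp
  · intro i j hij
    simp only [id_eq, Fin.lt_def] at hij
    exact upperT_of_lt c hij

/-- The infinite Toeplitz matrix `(b (i - j))_{i,j ≥ 0}` of a two-sided sequence. [folklore] -/
def toeplitzInf (b : ℤ → ℂ) : Matrix ℕ ℕ ℂ := fun i j => b ((i : ℤ) - j)

/-- Entries of `toeplitzInf`. [folklore] -/
@[simp] theorem toeplitzInf_apply (b : ℤ → ℂ) (i j : ℕ) : toeplitzInf b i j = b ((i : ℤ) - j) := rfl

/-- `U(c) L(a)` is the infinite Toeplitz matrix of `twoSided a c`. [folklore] -/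
theorem imul_upperT_lowerT_eq_toeplitzInf (a c : ℕ → ℂ) :
    imul (upperT c) (lowerT a) = toeplitzInf (twoSided a c) := by
  ext i j; rw [toeplitzInf_apply]; exact imul_upperT_lowerT_apply_eq_twoSided a c i j

end Literature.Analysis.Toeplitz
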